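import Summits.Parity.GeneralizedHardyLittlewood.Theorems.LeeYangFibresHyperbolicityClipsParityFibreClip
import Summits.Parity.GeneralizedHardyLittlewood.Theorems.LeeYangFibresHyperbolicityClipsParityPrep

/-!
# Route `LeeYangFibres`: the clipping lemma `HyperbolicityClipsParity` (stmt-Parity-14114)

We prove the route decl
`HyperbolicityClipsParity : CellParityLaw → FibreHyperbolicity → ModelCellFacts → PrimeCellsRelative`.

Constants are chosen in the order `ε → (δ, ε') → u₀ → η → u → (j₁, j₂, c) → ε_L → N₀`:
`K₁ = 2^t 8^{t-1}`, `δ = min(1/4, ε/(4 K₁ 2^t))` (fed to `ModelCellFacts`, giving `u₀`),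
`ε' = ε/(4K₁)`, `η = ε/(4·2^t·5^t)` (fed to `FibreHyperbolicity`, giving `u ≥ u₀` and `N_H`),
then `j₁, j₂, c, N_M` from `ModelCellFacts` at `u`, `ε_L = min(ε/2, ε' η c^t / u^{t-1})` (fed to
`CellParityLaw`, giving `θ` and `N_L`), `N₀ = max(N_H, N_M, N_L, 2)`.

For `N ≥ N₀` and admissible `Ψ, K`, with `X = β_∞ ∏β_p · (A₁/N)^t` and `Θ = W_θ(1,…,1) = ∑_S θ_S`:
`|C_{1…1} - X| ≤ |C_{1…1} - Θ X| + |Θ - 1| X ≤ ε_L N/log^t N + |Θ - 1| X`, and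

* if `β_∞ ∏β_p < ηN` (case A): `|Θ - 1| ≤ 2^{t+1}` and `X ≤ ηN (5/log N)^t` (Chebyshev), so
  `|Θ - 1| X ≤ (ε/2) N/log^t N`;
* if `β_∞ ∏β_p ≥ ηN` (case B): every fibre through every coordinate `i` is hyperbolic, and the
  fibre clipping lemma `fibre_clip` (Newton at `j₁, j₂` + interpolation on `{ρ(a₁/3), ρ(1)}^{t-1}`)
  gives `|θ_S| ≤ 8^{t-1}(2^t δ + ε')` for all `S ≠ ∅`, whence `|Θ - 1| ≤ K₁ 2^t δ + K₁ ε' ≤ ε/2`.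

The assembly is first proved for ABSTRACT cell counts `cell N u Ψ K j`, model counts `A N u m`
and main-term scale `MS Ψ K` (`clipsParity_assembly`), and then specialised to the route's
inlined objects by unification, so that no inlined expression of the Theses file is restated here.
-/

namespace Summit.Parity.GeneralizedHardyLittlewood.Theorems

open Finset Filter Literature.NumberTheory.Sieve HyperbolicityClipsParity

/-- Transfer of the smallness of the law's error to the normalised fibre scale:
`(ε_L N / Lg^t) u' ≤ ε' (M a_m) a₁^{t-1}` from `ε_L u' ≤ ε' η c^t`, `ηN ≤ M`, `c/Lg ≤ a_m, a₁`. -/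
theorem HyperbolicityClipsParity.smallness_transfer {t : ℕ} (ht : 1 ≤ t)
    {N Lg ε' η c εL u' M am a1 : ℝ} (hN : 0 < N) (hLg : 0 < Lg) (hε' : 0 ≤ ε') (hη : 0 ≤ η)
    (hc : 0 ≤ c) (hM : η * N ≤ M) (ham : c / Lg ≤ am) (ha1 : c / Lg ≤ a1)
    (hsmall : εL * u' ≤ ε' * η * c ^ t) :
    εL * N / Lg ^ t * u' ≤ ε' * (M * am) * a1 ^ (t - 1) := by
  have hcL : 0 ≤ c / Lg := div_nonneg hc hLg.le
  have hpow : (c / Lg) ^ (t - 1) ≤ a1 ^ (t - 1) := pow_le_pow_left₀ hcL ha1 _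
  have hid : η * c ^ t * N / Lg ^ t = η * N * (c / Lg) * (c / Lg) ^ (t - 1) := by
    have : (c / Lg) * (c / Lg) ^ (t - 1) = c ^ t / Lg ^ t := by
      rw [← pow_succ', Nat.sub_add_cancel ht, div_pow]
    rw [mul_assoc (η * N), this]
    field_simp
  calc εL * N / Lg ^ t * u' = εL * u' * (N / Lg ^ t) := by ring
    _ ≤ ε' * η * c ^ t * (N / Lg ^ t) :=
        mul_le_mul_of_nonneg_right hsmall (by positivity)
    _ = ε' * (η * c ^ t * N / Lg ^ t) := by ring
    _ = ε' * (η * N * (c / Lg) * (c / Lg) ^ (t - 1)) := by rw [hid]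
    _ ≤ ε' * (M * am * a1 ^ (t - 1)) := by
        refine mul_le_mul_of_nonneg_left ?_ hε'
        have h1 : η * N * (c / Lg) ≤ M * am :=
          mul_le_mul hM ham hcL (le_trans (by positivity) hM)
        exact mul_le_mul h1 hpow (pow_nonneg hcL _) (le_trans (by positivity) h1)
    _ = ε' * (M * am) * a1 ^ (t - 1) := by ring

/-- **The clipping lemma for abstract cell data.** The three route hypotheses, stated for abstract
joint cell counts `cell N u Ψ K j`, model cell counts `A N u m` and main-term scale `MS Ψ K`
(together with `MS ≥ 0`, Chebyshev `A N u 1 ≤ 5N/log N` and `∑_m A N u m ≤ N`), imply the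
conclusion of `PrimeCellsRelative` for these data. -/
theorem HyperbolicityClipsParity.clipsParity_assembly {t : ℕ} (ht : 1 ≤ t)
    {cell : ℕ → ℕ → (Fin t → AffLinForm 1) → Set (Fin 1 → ℝ) → (Fin t → ℕ) → ℕ}
    {A : ℕ → ℕ → ℕ → ℕ} {MS : (Fin t → AffLinForm 1) → Set (Fin 1 → ℝ) → ℝ}
    (hAsum : ∀ N u : ℕ, ∑ m ∈ Finset.Icc 1 u, (A N u m : ℝ) ≤ N)
    (hMS0 : ∀ (Ψ : Fin t → AffLinForm 1) (K : Set (Fin 1 → ℝ)), IsNondegenerateSystem Ψ → 0 ≤ MS Ψ K)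
    (hLaw : ∀ (L u : ℕ), 2 ≤ u → ∀ ε : ℝ, 0 < ε → ∃ N₀ : ℕ, ∀ N : ℕ, N₀ ≤ N →
      ∀ Ψ : Fin t → AffLinForm 1, IsNondegenerateSystem Ψ → affLinSize Ψ N ≤ L →
      ∀ K : Set (Fin 1 → ℝ), Convex ℝ K → K ⊆ realBox 1 N →
      ∃ θ : Finset (Fin t) → ℝ, θ ∅ = 1 ∧ (∀ S, |θ S| ≤ 2) ∧ ∀ j : Fin t → ℕ,
        (∀ i, 1 ≤ j i ∧ j i ≤ u) →
        |(cell N u Ψ K j : ℝ) - (∑ S : Finset (Fin t), θ S * ∏ i ∈ S, (-1 : ℝ) ^ (j i + 1)) *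
          (MS Ψ K * ∏ i, (A N u (j i) : ℝ) / N)| ≤ ε * N / Real.log N ^ t)
    (hHyp : ∀ (L u₀ : ℕ), ∀ η : ℝ, 0 < η → ∃ u : ℕ, u₀ ≤ u ∧ 2 ≤ u ∧ ∃ N₀ : ℕ, ∀ N : ℕ, N₀ ≤ N →
      ∀ Ψ : Fin t → AffLinForm 1, IsNondegenerateSystem Ψ → affLinSize Ψ N ≤ L →
      ∀ K : Set (Fin 1 → ℝ), Convex ℝ K → K ⊆ realBox 1 N → η * (N : ℝ) ≤ MS Ψ K →
      ∀ i : Fin t, ∀ w : Fin t → ℝ, (∀ k, 0 < w k ∧ w k ≤ 1) → ∀ ζ : ℂ,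
        (∑ j ∈ Fintype.piFinset (fun _ : Fin t => Finset.Icc 1 u),
          ((cell N u Ψ K j : ℕ) : ℂ) * ∏ k, (if k = i then ζ else ((w k : ℝ) : ℂ)) ^ (j k)) = 0 →
        ζ.im = 0)
    (hModel : ∀ ε : ℝ, 0 < ε → ∃ u₀ : ℕ, ∀ u : ℕ, u₀ ≤ u → ∃ j₁ j₂ : ℕ, Odd j₁ ∧ Even j₂ ∧
      2 ≤ j₁ ∧ j₁ + 2 ≤ u ∧ 2 ≤ j₂ ∧ j₂ + 2 ≤ u ∧ ∃ c : ℝ, 0 < c ∧ ∃ N₀ : ℕ, ∀ N : ℕ, N₀ ≤ N →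
      (∀ j ∈ ({1, j₁ - 1, j₁, j₁ + 1, j₂ - 1, j₂, j₂ + 1} : Finset ℕ),
        c * (N : ℝ) / Real.log N ≤ (A N u j : ℝ)) ∧
      (∀ j ∈ ({j₁, j₂} : Finset ℕ),
        (1 - ε) * (A N u j : ℝ) ^ 2 ≤ (A N u (j - 1) : ℝ) * (A N u (j + 1) : ℝ)) ∧
      |∑ j ∈ Finset.Icc 1 u, (-1 : ℝ) ^ j * (A N u j : ℝ)| ≤ ε * ∑ j ∈ Finset.Icc 1 u, (A N u j : ℝ))
    (hA1 : ∀ N u : ℕ, 2 ≤ N → (A N u 1 : ℝ) ≤ 5 * N / Real.log N)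
    (L : ℕ) (ε : ℝ) (hε : 0 < ε) :
    ∃ u : ℕ, 2 ≤ u ∧ ∃ N₀ : ℕ, ∀ N : ℕ, N₀ ≤ N → ∀ Ψ : Fin t → AffLinForm 1,
      IsNondegenerateSystem Ψ → affLinSize Ψ N ≤ L → ∀ K : Set (Fin 1 → ℝ), Convex ℝ K →
      K ⊆ realBox 1 N →
        |(cell N u Ψ K (fun _ => 1) : ℝ) - MS Ψ K * ((A N u 1 : ℝ) / N) ^ t| ≤
          ε * (MS Ψ K * ((A N u 1 : ℝ) / N) ^ t + N / Real.log N ^ t) := by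
  -- constants
  set K₁ : ℝ := 2 ^ t * 8 ^ (t - 1) with hK₁
  have hK₁pos : 0 < K₁ := by positivity
  set δ : ℝ := min (1 / 4) (ε / (4 * K₁ * 2 ^ t)) with hδ_def
  have hδpos : 0 < δ := lt_min (by norm_num) (by positivity)
  have hδ4 : δ ≤ 1 / 4 := min_le_left _ _
  have hδ1 : δ ≤ 1 := by linarith
  have hδK : K₁ * (2 ^ t * δ) ≤ ε / 4 := by
    have h := min_le_right (1 / 4 : ℝ) (ε / (4 * K₁ * 2 ^ t))
    rw [← hδ_def, le_div_iff₀ (by positivity)] at h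
    nlinarith [h]
  set ε' : ℝ := ε / (4 * K₁) with hε'_def
  have hε'pos : 0 < ε' := by positivity
  have hε'K : K₁ * ε' = ε / 4 := by rw [hε'_def]; field_simp
  obtain ⟨u₀, hu₀⟩ := hModel δ hδpos
  set η : ℝ := ε / (4 * 2 ^ t * 5 ^ t) with hη_def
  have hηpos : 0 < η := by positivity
  obtain ⟨u, hu₀u, hu2, N_H, hH⟩ := hHyp L u₀ η hηpos
  obtain ⟨j₁, j₂, hj₁, hj₂, h2j₁, hj₁u, h2j₂, hj₂u, c, hc, N_M, hMod⟩ := hu₀ u hu₀u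
  have hu1 : 1 ≤ u := by omega
  have hupos : (0 : ℝ) < u := by exact_mod_cast (by omega : 0 < u)
  set ε_L : ℝ := min (ε / 2) (ε' * η * c ^ t / (u : ℝ) ^ (t - 1)) with hε_L_def
  have hε_Lpos : 0 < ε_L := lt_min (by positivity) (by positivity)
  have hε_L2 : ε_L ≤ ε / 2 := min_le_left _ _
  have hε_Lsmall : ε_L * (u : ℝ) ^ (t - 1) ≤ ε' * η * c ^ t := by
    have h := min_le_right (ε / 2) (ε' * η * c ^ t / (u : ℝ) ^ (t - 1))
    rw [← hε_L_def, le_div_iff₀ (by positivity)] at h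
    exact h
  obtain ⟨N_L, hL⟩ := hLaw L u hu2 ε_L hε_Lpos
  refine ⟨u, hu2, max (max N_H N_M) (max N_L 2), ?_⟩
  intro N hN Ψ hΨ hsize K hK hKbox
  have hN_H : N_H ≤ N := le_trans (le_max_left _ _) (le_trans (le_max_left _ _) hN)
  have hN_M : N_M ≤ N := le_trans (le_max_right _ _) (le_trans (le_max_left _ _) hN)
  have hN_L : N_L ≤ N := le_trans (le_max_left _ _) (le_trans (le_max_right _ _) hN)
  have hN2 : 2 ≤ N := le_trans (le_max_right _ _) (le_trans (le_max_right _ _) hN)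
  have hNpos : (0 : ℝ) < N := by exact_mod_cast (by omega : 0 < N)
  have hlogpos : 0 < Real.log N := Real.log_pos (by exact_mod_cast (by omega : 1 < N))
  have hlogt : 0 < Real.log N ^ t := pow_pos hlogpos t
  obtain ⟨θ, hθ0, hθ2, hcells⟩ := hL N hN_L Ψ hΨ hsize K hK hKbox
  obtain ⟨hlow, hmarg, hbal⟩ := hMod N hN_M
  have hMS0' := hMS0 Ψ K hΨ
  -- densities `a m = A_m / N`
  set a : ℕ → ℝ := fun m => (A N u m : ℝ) / N with ha_def
  have ha0 : ∀ m, 0 ≤ a m := fun m => div_nonneg (Nat.cast_nonneg _) hNpos.le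
  have hlow' : ∀ m ∈ ({1, j₁ - 1, j₁, j₁ + 1, j₂ - 1, j₂, j₂ + 1} : Finset ℕ),
      c / Real.log N ≤ a m := fun m hm => density_lower hNpos (hlow m hm)
  have hclog : 0 < c / Real.log N := div_pos hc hlogpos
  have ha1pos : 0 < a 1 := lt_of_lt_of_le hclog (hlow' 1 (by simp))
  have hasum : ∑ m ∈ Finset.Icc 1 u, a m ≤ 1 := by
    have : ∑ m ∈ Finset.Icc 1 u, a m = (∑ m ∈ Finset.Icc 1 u, (A N u m : ℝ)) / N := by
      rw [Finset.sum_div]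
    rw [this, div_le_one hNpos]
    exact hAsum N u
  have ha1le : (A N u 1 : ℝ) / N ≤ 5 / Real.log N := by
    rw [div_le_div_iff₀ hNpos hlogpos]
    have := hA1 N u hN2
    rw [le_div_iff₀ hlogpos] at this
    linarith
  -- the prime cell
  have hprime : |(cell N u Ψ K (fun _ => 1) : ℝ) -
      (∑ S : Finset (Fin t), θ S * ∏ _i ∈ S, (-1 : ℝ) ^ (1 + 1)) *
        (MS Ψ K * ∏ _i : Fin t, (A N u 1 : ℝ) / N)| ≤ ε_L * N / Real.log N ^ t :=
    hcells (fun _ => 1) (fun _ => ⟨le_rfl, hu1⟩)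
  have hprod1 : ∏ _i : Fin t, (A N u 1 : ℝ) / N = ((A N u 1 : ℝ) / N) ^ t := by
    rw [Finset.prod_const, Finset.card_univ, Fintype.card_fin]
  rw [hprod1] at hprime
  set Θ : ℝ := ∑ S : Finset (Fin t), θ S * ∏ _i ∈ S, (-1 : ℝ) ^ (1 + 1) with hΘ_def
  set X : ℝ := MS Ψ K * ((A N u 1 : ℝ) / N) ^ t with hX_def
  have hX0 : 0 ≤ X := mul_nonneg hMS0' (pow_nonneg (ha0 1) t)
  have hNlog0 : 0 ≤ (N : ℝ) / Real.log N ^ t := by positivity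
  -- the key estimate in the two cases
  have hkey : |Θ - 1| * X ≤ ε / 2 * X + ε / 2 * (N / Real.log N ^ t) := by
    by_cases hcase : MS Ψ K < η * N
    · -- case A: small singular mass
      have hΘ1 : |Θ - 1| ≤ 2 ^ t * 2 :=
        abs_walsh_primeCell_sub_one_le θ hθ0 (by norm_num) fun S _ => hθ2 S
      have hXle : X ≤ η * N * (5 / Real.log N) ^ t :=
        mul_le_mul hcase.le (pow_le_pow_left₀ (ha0 1) ha1le t) (pow_nonneg (ha0 1) t)
          (by positivity)
      have hid : (2 : ℝ) ^ t * 2 * (η * N * (5 / Real.log N) ^ t) = ε / 2 * (N / Real.log N ^ t) := by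
        rw [hη_def, div_pow]
        field_simp
        ring
      calc |Θ - 1| * X ≤ 2 ^ t * 2 * (η * N * (5 / Real.log N) ^ t) :=
            mul_le_mul hΘ1 hXle hX0 (by positivity)
        _ = ε / 2 * (N / Real.log N ^ t) := hid
        _ ≤ ε / 2 * X + ε / 2 * (N / Real.log N ^ t) :=
            le_add_of_nonneg_left (by positivity)
    · -- case B: the fibres are hyperbolic
      rw [not_lt] at hcase
      have hMSpos : 0 < MS Ψ K := lt_of_lt_of_le (by positivity) hcase
      have hτ : ∀ S : Finset (Fin t), S ≠ ∅ → |θ S| ≤ 8 ^ (t - 1) * (2 ^ t * δ + ε') := by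
        refine theta_small_of_fibres θ fun i => ?_
        refine fibre_clip i hu1 θ hθ2 a ha0 ha1pos hasum hδ4
          (density_balance hNpos (fun n => (A N u n : ℝ)) hbal) hj₁ hj₂ h2j₁ (by omega) h2j₂
          (by omega) (fun m hm => lt_of_lt_of_le hclog (hlow' m (Finset.mem_insert_of_mem hm)))
          hδpos.le hδ1 (fun m hm => density_margin hNpos (hmarg m hm))
          (fun j => (cell N u Ψ K j : ℝ)) (fun j => Nat.cast_nonneg _) hMSpos
          (E₀ := ε_L * N / Real.log N ^ t) (by positivity) (fun j hj => hcells j fun k =>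
            Finset.mem_Icc.1 (Fintype.mem_piFinset.1 hj k)) ?_ hε'pos.le ?_
        · intro w hw z hz
          exact hH N hN_H Ψ hΨ hsize K hK hKbox hcase i w hw z
            ((fibreSum_cast _ _ i w z).symm.trans hz)
        · intro m hm
          exact smallness_transfer ht hNpos hlogpos hε'pos.le hηpos.le hc.le hcase
            (hlow' m (Finset.mem_insert_of_mem hm)) (hlow' 1 (by simp)) hε_Lsmall
      have hΘ1 : |Θ - 1| ≤ ε / 2 :=
        calc |Θ - 1| ≤ 2 ^ t * (8 ^ (t - 1) * (2 ^ t * δ + ε')) :=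
              abs_walsh_primeCell_sub_one_le θ hθ0 (by positivity) hτ
          _ = K₁ * (2 ^ t * δ) + K₁ * ε' := by rw [hK₁]; ring
          _ ≤ ε / 4 + ε / 4 := add_le_add hδK hε'K.le
          _ = ε / 2 := by ring
      calc |Θ - 1| * X ≤ ε / 2 * X := mul_le_mul_of_nonneg_right hΘ1 hX0
        _ ≤ ε / 2 * X + ε / 2 * (N / Real.log N ^ t) :=
            le_add_of_nonneg_right (by positivity)
  -- conclusion
  have hsplit : (cell N u Ψ K (fun _ => 1) : ℝ) - X =
      ((cell N u Ψ K (fun _ => 1) : ℝ) - Θ * X) + (Θ - 1) * X := by ring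
  have hL2 : ε_L * N / Real.log N ^ t ≤ ε / 2 * (N / Real.log N ^ t) := by
    rw [mul_div_assoc]
    exact mul_le_mul_of_nonneg_right hε_L2 hNlog0
  calc |(cell N u Ψ K (fun _ => 1) : ℝ) - X|
      = |((cell N u Ψ K (fun _ => 1) : ℝ) - Θ * X) + (Θ - 1) * X| := by rw [hsplit]
    _ ≤ |(cell N u Ψ K (fun _ => 1) : ℝ) - Θ * X| + |(Θ - 1) * X| := abs_add_le _ _
    _ ≤ ε_L * N / Real.log N ^ t + |Θ - 1| * X := by
        rw [abs_mul, abs_of_nonneg hX0]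
        exact add_le_add hprime le_rfl
    _ ≤ ε / 2 * (N / Real.log N ^ t) + (ε / 2 * X + ε / 2 * (N / Real.log N ^ t)) :=
        add_le_add hL2 hkey
    _ ≤ ε * (X + N / Real.log N ^ t) := by nlinarith [mul_nonneg hε.le hX0]

/-- **`HyperbolicityClipsParity`** (route `LeeYangFibres`, item stmt-Parity-14114): the cell-parity
law, fibre hyperbolicity and the model cell facts imply the prime-cell asymptotics with relative
error, `PrimeCellsRelative`. The route's inlined objects (joint rough `Ω`-cells, model cells,
`β_∞ ∏_p β_p`) enter `clipsParity_assembly` by unification. -/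
theorem HyperbolicityClipsParity_proof :
    Summit.Parity.GeneralizedHardyLittlewood.Theses.LeeYangFibres.HyperbolicityClipsParity := by
  intro hLaw hHyp hModel t L ht ε hε
  exact HyperbolicityClipsParity.clipsParity_assembly ht
    (fun N u => sum_modelCells_le N u)
    (fun Ψ K hΨ => archFactor_mul_singularProduct_nonneg Ψ hΨ K)
    (fun L u hu ε hε => hLaw t L u ht hu ε hε) (fun L u₀ η hη => hHyp t L u₀ ht η hη) hModel
    (fun N u hN => modelCell_one_le hN u) L ε hε

end Summit.Parity.GeneralizedHardyLittlewood.Theorems
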